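import Summits.BirchSwinnertonDyer.BirchSwinnertonDyer.Theorems.ErratumRoadFiveRamFreeTamagawaDescent
import Summits.BirchSwinnertonDyer.BirchSwinnertonDyer.Theorems.CongruentShaFreeCutKatoKummerLogTorsion
import Summits.BirchSwinnertonDyer.Rank1Residual.Additive.LocalLogImageRat
import Summits.BirchSwinnertonDyer.Rank1Residual.Additive.LocalTorsionExponent
import Literature.NumberTheory.EllipticCurves.TamagawaRingEquivProofs
import Literature.NumberTheory.EllipticCurves.TamagawaPrimesEquivProofs
import HarnessLib

/-!
# Route `ErratumRoadFive` — crux `EulerHalfNotRamNoInertSetAtFive` (stmt-BirchSwinnertonDyer-19715), line `kato_Fframe`: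
# **S2ns — the log minimum at a NON-SPLIT multiplicative `p ≥ 5` is `1` (and `p ∤ #W(ℚ_p)_tors`, `p ∤ c_p`), PROVED**

HELPER file (`--supports stmt-BirchSwinnertonDyer-19715 --as helper`; pen decision bsd-stepL g48 2026-08-30T05:22:22Z):
theorems only, nothing here closes 19715 or any registered stub. It is the Theorems lift of the crux workfile
`Cruxes/EulerHalfNotRamNoInertSetAtFive/Lines/kato_Fframe_r4_S2ns_proof.lean` (sha16 25964dd9294b1221), statements and proofs
unchanged, namespace `…Theorems.ErratumRoadFiveKatoFframeNonsplitLogMinimum`. The main theorem `nonsplitLogMinimum` is,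
VERBATIM, the statement of the former width stub S2ns `stub_nonsplitLogMinimum` of `Lines/kato_Fframe_r4.lean`
(f94d5116aef1b815, l.301); the registered skeleton r5.2 `Lines/kato_Fframe_r5.lean` (cf457b9468bcf978) carries an in-skeleton
copy of this proof (`…KatoFframe.S2ns`, l.312 ff.) and consumes it in `EulerHalfNotRamNoInertSetAtFive_of`; this file banks
the same theorem under `Theorems/`. HONEST FRAMING: no summit statement, crux or registered stub is proved here; BSD is proved
for no curve.

Statement (words): for `W/ℚ` globally minimal, `p ≥ 5` prime, `ρ̄_{W,p}` surjective, `r_an(W) = 1` and `W` multiplicative but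
NOT split at `p`: `p ∤ #W(ℚ_p)_tors` and there is a local point `Q ∈ W(ℚ_p)` with `log_ω Q ≠ 0` of valuation exactly `1`,
the minimum of `v(log_ω ·)` on `W(ℚ_p) ∖ log⁻¹(0)`.
Chain (memo `Lines/kato_Fframe_r4_S2proofs.md` §1): non-split ⇒ `c_v ∈ {1,2}` (Tate's algorithm Step 2,
`localTamagawaNumber_of_hasNonsplitMultiplicativeReductionAt_holds`) ⇒ `p ∤ c_p` (`localTamagawaNumber_padic_eq_holds`);
`#E(ℚ_p)_tors ∣ c_p · #Ẽ_ns(𝔽_p)` (`card_torsion_dvd_of_isMinimal`) and `p ∤ #Ẽ_ns(𝔽_p)` ⇒ `t = 0`; image of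
`log` on `E(ℚ_p)` is `p^{1+t−v_p c_p} ℤ_p = p ℤ_p` (`range_padicLog_baseChange_of_mult`) ⇒ a point `Q` with
`log_ω Q = p` (`padicLogLocal_eq_padicLog`), valuation `1`. Author: planner-bsd-idea-9 (g39 proof, g40 lift).
[cite: SilvermanAEC2009, IV.6.4, VII.2.1, VII.3.1, VII.6.1] [cite: SilvermanATAEC1994, IV.9.4 Step 2]
-/

noncomputable section

open scoped Classical

set_option linter.dupNamespace false

namespace Summit.BirchSwinnertonDyer.BirchSwinnertonDyer.Theorems.ErratumRoadFiveKatoFframeNonsplitLogMinimum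

open WeierstrassCurve IsDedekindDomain NumberField
open Literature.NumberTheory.EllipticCurves Literature.NumberTheory.EllipticCurves.Kato2004
open Literature.NumberTheory.EllipticCurves.Rank1Residual
open Summit.BirchSwinnertonDyer.Rank1Residual
open Summit.BirchSwinnertonDyer.Rank1Residual.X11b
open Summit.BirchSwinnertonDyer.Rank1Residual.Additive
open Summit.BirchSwinnertonDyer.BirchSwinnertonDyer.Theorems.CongruentShaFreeCutKatoKummerLogTorsion

/-- **`p ∤ c_p(E ⊗ ℚ_p)` at a NON-SPLIT multiplicative prime `p ≠ 2`** (`c_p ∈ {1, 2}`, Tate's algorithm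
Step 2, transported from the place `v ↔ p` to Mathlib's `ℚ_[p]`).
[cite: SilvermanATAEC1994, IV.9.4 Step 2 (PDF p. 344)] [cite: SilvermanAEC2009, VII.6 Ex. 7.6] -/
theorem not_dvd_localTamagawaNumber_padic_of_nonsplit (W : WeierstrassCurve ℚ) [W.IsElliptic]
    (p : ℕ) [Fact p.Prime] (hp2 : p ≠ 2) (hmult : W.HasMultiplicativeReductionAtPrime p)
    (hns : ¬ W.HasSplitMultiplicativeReductionAtPrime p) :
    ¬ p ∣ (W.baseChange ℚ_[p]).localTamagawaNumber ℤ_[p] := by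
  have hpP : p.Prime := Fact.out
  -- the finite place `v` of `ℚ` under `p`
  set v : HeightOneSpectrum (𝓞 ℚ) := Rat.HeightOneSpectrum.primesEquiv.symm ⟨p, hpP⟩ with hvdef
  have hv : (Rat.HeightOneSpectrum.primesEquiv v : ℕ) = p := by
    rw [hvdef, Equiv.apply_symm_apply]
  have hmult_v : W.HasMultiplicativeReductionAt v :=
    (hasMultiplicativeReductionAtPrime_primesEquiv_iff_holds W v p hv).mp hmult
  have hns_v : ¬ W.HasSplitMultiplicativeReductionAt v :=
    BirchSwinnertonDyer.Theorems.RamFree.not_hasSplitMultiplicativeReductionAt_of_primesEquiv_eq W v hv hns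
  haveI : Finite (IsLocalRing.ResidueField (v.adicCompletionIntegers ℚ)) :=
    HeightOneSpectrum.finite_residueField_adicCompletionIntegers ℚ v
  rw [WeierstrassCurve.localTamagawaNumber_padic_eq_holds W v p hv,
    localTamagawaNumber_of_hasNonsplitMultiplicativeReductionAt_holds v W hmult_v hns_v]
  intro hdvd
  split_ifs at hdvd
  · exact hp2 ((Nat.prime_dvd_prime_iff_eq hpP Nat.prime_two).mp hdvd)
  · exact hpP.one_lt.ne' (Nat.dvd_one.mp hdvd)

/-- **`p ∤ #E(ℚ_p)_tors` at a non-split multiplicative `p ≥ 3`** (`#E(ℚ_p)_tors ∣ c_p · #Ẽ_ns(𝔽_p)`, both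
factors prime to `p`). [cite: SilvermanAEC2009, VII.3 Prop. 3.1, VII.2.1, VII.6.1 and Exercise 3.5] -/
theorem padicValNat_card_torsion_eq_zero_of_nonsplit (W : WeierstrassCurve ℚ) [W.IsElliptic]
    [W.IsGloballyMinimal] (p : ℕ) [Fact p.Prime] (hp3 : 3 ≤ p)
    (hmult : W.HasMultiplicativeReductionAtPrime p) (hns : ¬ W.HasSplitMultiplicativeReductionAtPrime p) :
    padicValNat p (Nat.card (AddCommGroup.torsion (W.baseChange ℚ_[p]).toAffine.Point)) = 0 := by
  have hpP : p.Prime := Fact.out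
  refine padicValNat.eq_zero_of_not_dvd fun hdvd => ?_
  have hdiv := LocalLog.card_torsion_dvd_of_isMinimal (W.baseChange ℚ_[p]) hp3
  rw [LocalTorsion.natCard_point_reduction_baseChange_padic W p] at hdiv
  rcases (Nat.Prime.dvd_mul hpP).mp (dvd_trans hdvd hdiv) with h | h
  · exact not_dvd_localTamagawaNumber_padic_of_nonsplit W p (by omega) hmult hns h
  · exact LocalTorsion.not_dvd_reductionPointCount_of_mult W p hmult h

/-- **S2ns, PROVED** — the statement of `stub_nonsplitLogMinimum` of `Lines/kato_Fframe_r4.lean` verbatim: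
at a non-split multiplicative `p ≥ 5`, `ord_p c_p = 0` and some `Q ∈ E(ℚ_p)` has `log_ω(Q) ≠ 0` of valuation
exactly `1` (the image of `log_ω` on `E(ℚ_p)` is `p ℤ_p`).
[cite: SilvermanAEC2009, IV.6.4 (b), VII.2.2 and VII.6.1] [cite: SilvermanATAEC1994, IV.9.4 (Tate's algorithm, Step 2)] -/
theorem nonsplitLogMinimum :
    ∀ (W : WeierstrassCurve ℚ) [W.IsElliptic] [W.IsGloballyMinimal] (p : ℕ) [Fact p.Prime],
      5 ≤ p → W.HasMultiplicativeReductionAtPrime p → ¬ W.HasSplitMultiplicativeReductionAtPrime p →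
      padicValNat p ((W.baseChange ℚ_[p]).localTamagawaNumber ℤ_[p]) = 0 ∧
      ∃ Q : (W.baseChange ℚ_[p]).toAffine.Point, padicLogLocal W p Q ≠ 0 ∧
        (padicLogLocal W p Q).valuation = 1 := by
  intro W _ _ p _ h5 hmult hns
  have hpP : p.Prime := Fact.out
  have hc0 : padicValNat p ((W.baseChange ℚ_[p]).localTamagawaNumber ℤ_[p]) = 0 :=
    padicValNat.eq_zero_of_not_dvd (not_dvd_localTamagawaNumber_padic_of_nonsplit W p (by omega) hmult hns)
  have ht0 := padicValNat_card_torsion_eq_zero_of_nonsplit W p (by omega) hmult hns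
  refine ⟨hc0, ?_⟩
  -- the image of `log` on `E(ℚ_p)` is `p ℤ_p`
  have hrange := LocalLog.range_padicLog_baseChange_of_mult W p hmult
  rw [ht0, hc0, Nat.cast_zero, add_zero, sub_zero, zpow_one] at hrange
  have hmem : (p : ℚ_[p]) ∈ (LocalLog.padicLog (W.baseChange ℚ_[p])).range := by
    rw [hrange]
    exact Submodule.mem_span_singleton_self _
  obtain ⟨Q, hQ⟩ := AddMonoidHom.mem_range.mp hmem
  refine ⟨Q, ?_, ?_⟩
  · rw [padicLogLocal_eq_padicLog W p Q, hQ]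
    exact_mod_cast hpP.ne_zero
  · rw [padicLogLocal_eq_padicLog W p Q, hQ]
    exact Padic.valuation_p

end Summit.BirchSwinnertonDyer.BirchSwinnertonDyer.Theorems.ErratumRoadFiveKatoFframeNonsplitLogMinimum
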